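import Summits.QuantumFields.YangMills.Theorems.BalabanUVNodesK0RecordFormatNamesBetaKernel
import Summits.QuantumFields.YangMills.Theorems.BalabanUVNodesK1AxBetaContKernel
import Summits.QuantumFields.YangMills.Theorems.BalabanUVNodesK0AxMomentSocketTight

/-!
# K0⁷ ∕ K1ᴬ — RECORD-SIDE FORMAT NAMES, LEMMAS 16: faces of edition 25's β-KERNEL LETTERS — the ORDER among the generic letters (the K0 road's three kernels
# re-keyed generic, proofs copied), the K0 instances (`Iff.rfl`), and ★ PTB-1's kernel ✓`…K1AxBetaContKernel` read over the NAMES (Stage 8; Stage-13-Ax: `SurvCont`)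

Cell `ym-nodeO-ideate`, DEFINER seat `ym-nodeO-def-1` (gen 37); `--kind proof --supports stmt-QuantumFields-20541 --as helper`; count-neutral; THEOREMS ONLY.
ORDER OF RECORD: director-ym №555 (2)(ℓ1); ◆ CRIT-1 g37 l.5147 (dedup map) ∕ l.5152 («re-key the four letters + three kernels from `(F, a₀, ε₂₉)∕thetaFill` to generic
`(fam, ρ, bV)` — then BOTH records instantiate, proofs copied»).  [I] = [Balaban1987RG1].

WHAT THIS FILE IS (theorems only; every hypothesis is a displayed letter of ✓`…K0RecordFormatNamesBetaKernel` ∕ ✓`…Decay`, discharged by nobody):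
* §1 ORDER, GENERIC over `(fam, ρ, bV)`: `polLimitLocUnifOnBoxOf_of_polLimitOnBoxOf_of_locUnifCauchy` ((L-lim-box) `PolLimitOnBoxOf` + (V-lucauchy) ⟹ (T-β1);
  `UniformCauchySeqOn.tendstoUniformlyOn_of_tendsto` on a relative box-neighbourhood, `tendstoLocallyUniformlyOn_of_forall_exists_nhds`) · `tendsto_of_polLimitLocUnifOnBoxOf`
  ((T-β1) ⟹ the `(0,1)`-entries converge at every box history) · `pvolContEvOnBoxOf_of_pvolHistContOnBoxOf` ((T-β3) ⟹ (V-cont-ev)) · `plimContOnBoxOf_of_locUnif_of_contEv`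
  ((T-β1)+(V-cont-ev) ⟹ (L-cont), `TendstoLocallyUniformlyOn.continuousOn`) · `plimContOnBoxOf_of_polLimitOnBoxOf_of_contEv_of_locUnifCauchy` (= the K0 kernel
  `recordPlimContOnBoxAx_of_pvol_loc`, generic) · `plimMomentDominatedOnBoxOf_of_decayBox` ∕ `…_of_plimDecayOnBoxOf` (per-scale ∕ uniform (5.10) ⟹ (L-dom) = the K0 kernel
  `recordPlimMomentDominatedOnBoxAx_of_decayBox`, generic) · ★ `betaContH_secondMoment_plimOf_of_cont_dominated` ((L-cont)+(L-dom) ⟹ `BetaContH γ (secondMoment ∘ plimOf)` =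
  the K0 kernel `betaContH_thetaFill_of_cont_dominated` without its `thetaFill` identity; Mathlib's `continuousOn_tsum`) · `betaContH_secondMoment_plimOf_of_letters` (★ PTB-1's
  kernel ✓`K1AxBetaContKernel.betaContH_secondMoment_plimOf` over the NAMES (T-β1)(T-β2)(T-β3), by unfolding); §1b LEVEL MONOTONICITY `…_mono` for all seven generic
  letters (smaller box `γ' ≤ γ`; the citable generic home — dag-lead WORDS 745∕746) and, in §3, for the three Stage-13-Ax instances.
* §2 THE K0 INSTANCES (`Iff.rfl` ∕ `rfl`): `famOfRecord₁₃Ax F 2 (thetaFill F a₀ ε₂₉) = recordTermsAx F a₀ ε₂₉`; the K0 road's four letters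
  `K0AxMomentRoad.RecordPvolContOnBoxAx ∕ RecordPvolLocUniformCauchyOnBoxAx ∕ RecordPlimContOnBoxAx ∕ RecordPlimMomentDominatedOnBoxAx F a₀ ε₂₉ γ` ARE edition 25's generic
  letters at `(recordTermsAx F a₀ ε₂₉, θfill.ρ8, θfill.bV)`; the Stage-13-Ax instances at `θ := thetaFill F a₀ ε₂₉` read `recordPvolAx ∕ recordPlimAx`.
* §3 RECORD FACES OVER THE NAMES (★ PTB-1's ✓p820605 §4 re-read): `betaOfRecord₁₃Ax_eq_secondMoment_plimOf` (on its box the re-centred β IS the second moment of `plimOf` of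
  `famOfRecord₁₃Ax`); ★ `betaContH_betaOfRecord₁₃Ax_of_letters₁₃Ax` and ★★ `survCont_betaOfRecord₁₃Ax_of_letters₁₃Ax` — `0 < γ₀ ≤ γ ≤ θ.γ`,
  `PolLimitLocUnifOnBox₁₃Ax F N θ γ → PlimDecayOnBox₁₃Ax F N θ γ C δ₁ → PvolHistContOnBox₁₃Ax F N θ γ → SurvCont (betaOfRecord₁₃Ax F N θ) γ₀`: the (C) conjunct K1ᴬ's
  `stub_cont13` adds at a rows witness, over ONE NAME per letter (cf. the skeleton's `stubCont13_of_cont13All`, which reads (C) at the presenting tuple `θ'` at level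
  `min γ₀ w.γ ≤ θ'.γ`).

HONEST FRAMING.  Order ∕ instance ∕ face lemmas (pure analysis and `rfl`s); NO estimate of Bałaban's; (T-β1)(T-β2) OPEN [I] §1∕§5 content discharged by nobody, (T-β3) not proved
here; K1ᴬ ⟨stmt-QuantumFields-27239⟩ 0∕6; K0ᴬ∕K1ᴬ∕K3ᴬ 0∕3; NODE O not inhabited (0∕1); COUNT 8∕28 · K 1∕4 UNMOVED; finite `𝕋⁴_{L^K}` at fixed ε — NOT continuum ∕ ℝ⁴ ∕ OS;
**the Yang–Mills mass gap (Clay) is NOT proved by any of this.**  No `sorry`; standard axioms.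
-/

noncomputable section

open scoped BigOperators Matrix.Norms.L2Operator Topology
open Set Filter

namespace Summit.QuantumFields.YangMills.Theorems.K0RecordFormatNames

open Literature.MathematicalPhysics.QuantumFieldTheory.Balaban1983to89
open Literature.MathematicalPhysics.QuantumFieldTheory.Balaban1983to89.Node00
open Literature.MathematicalPhysics.QuantumFieldTheory.Balaban1983to89.T4Continuum (T4Family)
open Literature.MathematicalPhysics.QuantumFieldTheory.Balaban1983to89.FlowStep
open Literature.MathematicalPhysics.QuantumFieldTheory.Balaban1983to89.B12Sec2to5 (l1 Decay510 majorant_summable abs_term_le_of_decay510)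
open Summit.QuantumFields.YangMills.Theorems.BalabanUVNodesK2NamedJetsRunRemAt (SurvCont)
open Summit.QuantumFields.YangMills.Theorems.K0AxMomentRoad (RecordPvolContOnBoxAx RecordPvolLocUniformCauchyOnBoxAx RecordPlimContOnBoxAx
  RecordPlimMomentDominatedOnBoxAx)

variable (F : T4Family)

/-! ## §1  ORDER among the generic letters; the K0 road's kernels re-keyed generic -/

section Generic

variable {𝔄 : Type*} [NormedRing 𝔄] [NormedAlgebra ℝ 𝔄]
variable {V : Type*} [NormedAddCommGroup V] [NormedSpace ℝ V] {ι : Type*} [Fintype ι]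
variable (fam : TermFamily1 F 𝔄) (ρ : V →L[ℝ] 𝔄) (bV : Module.Basis ι ℝ V)

/-- **(L-lim-box) + (V-lucauchy) ⟹ (T-β1)**: the pointwise (1.21) letter on the box and local uniform Cauchy-ness in the volume give locally uniform convergence of the
finite-volume `(0,1)`-entries to the limit entries (`UniformCauchySeqOn.tendstoUniformlyOn_of_tendsto` on `t ∩ Box`, `tendstoLocallyUniformlyOn_of_forall_exists_nhds`).
So every supplier of the K0 road's (L-lim-box) ∧ (V-lucauchy-box) (e.g. the two-volume letter (E-lu-box) of `…K0AxMomentSocketTight` §8e) pays (T-β1). [folklore] -/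
theorem polLimitLocUnifOnBoxOf_of_polLimitOnBoxOf_of_locUnifCauchy {γ : ℝ} (hlim : PolLimitOnBoxOf F fam ρ bV γ)
    (hu : PvolLocUnifCauchyOnBoxOf F fam ρ bV γ) : PolLimitLocUnifOnBoxOf F fam ρ bV γ := by
  intro k z
  refine tendstoLocallyUniformlyOn_of_forall_exists_nhds fun v hv => ?_
  obtain ⟨t, ht, hU⟩ := hu k z v hv
  refine ⟨t ∩ Box γ k, Filter.inter_mem ht self_mem_nhdsWithin, ?_⟩
  exact (hU.mono Set.inter_subset_left).tendstoUniformlyOn_of_tendsto fun w hw =>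
    tendsto_pvolOf F fam ρ bV k w (hlim k w hw.2) 0 1 z

/-- **(T-β1) ⟹ the `(0,1)`-entries converge at every box history** (`TendstoLocallyUniformlyOn.tendsto_at`): the locally uniform letter contains the pointwise (1.21)
letter for the entry it names. [folklore] -/
theorem tendsto_of_polLimitLocUnifOnBoxOf {γ : ℝ} (h : PolLimitLocUnifOnBoxOf F fam ρ bV γ) {k : ℕ} {v : Fin (k + 1) → ℝ} (hv : v ∈ Box γ k)
    (z : Fin 4 → ℤ) : Tendsto (fun K => pvolOf F fam ρ bV k v K 0 1 z) atTop (𝓝 (plimOf F fam ρ bV k v 0 1 z)) :=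
  (h k z).tendsto_at hv

/-- **(T-β3) ⟹ (V-cont-ev)** (continuity at every volume gives it for cofinally many). [folklore] -/
theorem pvolContEvOnBoxOf_of_pvolHistContOnBoxOf {γ : ℝ} (h : PvolHistContOnBoxOf F fam ρ bV γ) : PvolContEvOnBoxOf F fam ρ bV γ :=
  fun k z => Frequently.of_forall fun K => h k K z

/-- **(T-β1) + (V-cont-ev) ⟹ (L-cont)** (`TendstoLocallyUniformlyOn.continuousOn`; = ✓`K1AxBetaContKernel.continuousOn_plimOf_entry` with the frequently-form of (T-β3)). [folklore] -/
theorem plimContOnBoxOf_of_locUnif_of_contEv {γ : ℝ} (h1 : PolLimitLocUnifOnBoxOf F fam ρ bV γ) (h3 : PvolContEvOnBoxOf F fam ρ bV γ) :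
    PlimContOnBoxOf F fam ρ bV γ :=
  fun k z => (h1 k z).continuousOn (h3 k z)

/-- **(T-β1) + (T-β3) ⟹ (L-cont)**. [folklore] -/
theorem plimContOnBoxOf_of_locUnif_of_histCont {γ : ℝ} (h1 : PolLimitLocUnifOnBoxOf F fam ρ bV γ) (h3 : PvolHistContOnBoxOf F fam ρ bV γ) :
    PlimContOnBoxOf F fam ρ bV γ :=
  plimContOnBoxOf_of_locUnif_of_contEv F fam ρ bV h1 (pvolContEvOnBoxOf_of_pvolHistContOnBoxOf F fam ρ bV h3)

/-- **(L-lim-box) + (V-cont-ev) + (V-lucauchy) ⟹ (L-cont)** — the K0 road's ★ `K0AxMomentRoad.recordPlimContOnBoxAx_of_pvol_loc` RE-KEYED GENERIC (same proof, through (T-β1)).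
[cite: Balaban1987RG1, (1.21)–(1.22) p.264] -/
theorem plimContOnBoxOf_of_polLimitOnBoxOf_of_contEv_of_locUnifCauchy {γ : ℝ} (hlim : PolLimitOnBoxOf F fam ρ bV γ) (hc : PvolContEvOnBoxOf F fam ρ bV γ)
    (hu : PvolLocUnifCauchyOnBoxOf F fam ρ bV γ) : PlimContOnBoxOf F fam ρ bV γ :=
  plimContOnBoxOf_of_locUnif_of_contEv F fam ρ bV (polLimitLocUnifOnBoxOf_of_polLimitOnBoxOf_of_locUnifCauchy F fam ρ bV hlim hu) hc

/-- **Per-scale box (5.10) ⟹ (L-dom)** with `m_k := C_k·(|z|₁² e^{−δ_{1,k}|z|₁})` — the K0 road's `K0AxMomentRoad.recordPlimMomentDominatedOnBoxAx_of_decayBox` RE-KEYED GENERIC (proof copied: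
`B12Sec2to5.abs_term_le_of_decay510`, `majorant_summable`). [cite: Balaban1987RG1, (5.10) p.293, (5.42) p.297] -/
theorem plimMomentDominatedOnBoxOf_of_decayBox {γ : ℝ}
    (h : ∀ k : ℕ, ∃ C δ₁ : ℝ, 0 < δ₁ ∧ ∀ (v : Fin (k + 1) → ℝ), v ∈ Box γ k → Decay510 (plimOf F fam ρ bV k v 0 1) C δ₁) :
    PlimMomentDominatedOnBoxOf F fam ρ bV γ := fun k => by
  obtain ⟨C, δ₁, hδ, hd⟩ := h k
  refine ⟨fun z => C * (l1 z ^ 2 * Real.exp (-δ₁ * l1 z)), (majorant_summable hδ 4).mul_left C, fun v hv z => ?_⟩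
  have := abs_term_le_of_decay510 (hd v hv) 0 1 z
  rwa [abs_mul, abs_mul] at this

/-- **(T-β2) ⟹ (L-dom)** (ONE `(C, δ₁)` for all scales is per-scale decay in particular). [cite: Balaban1987RG1, (5.10) p.293, (5.42) p.297] -/
theorem plimMomentDominatedOnBoxOf_of_plimDecayOnBoxOf {γ C δ₁ : ℝ} (h : PlimDecayOnBoxOf F fam ρ bV γ C δ₁) :
    PlimMomentDominatedOnBoxOf F fam ρ bV γ :=
  plimMomentDominatedOnBoxOf_of_decayBox F fam ρ bV fun k => ⟨C, δ₁, h.1, fun v hv => h.2 k v hv⟩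

/-- ★ **(L-cont) + (L-dom) ⟹ (C) ON THE BOXES for the second moment of the limit kernel, RATE-FREE**: `BetaContH γ (fun k v => secondMoment (plimOf F fam ρ bV k v) 0 1)` —
the K0 road's ★ `K0AxMomentRoad.betaContH_thetaFill_of_cont_dominated` RE-KEYED GENERIC (Mathlib's `continuousOn_tsum`, the Weierstrass M-test with the per-scale majorant `m_k`;
no `thetaFill` identity needed at the generic level, no `γ ≤ ½` guard). [cite: Balaban1987RG1, §1 p.264 (after (1.22)), (1.22) p.264, (5.42) p.297] -/
theorem betaContH_secondMoment_plimOf_of_cont_dominated {γ : ℝ} (hc : PlimContOnBoxOf F fam ρ bV γ) (hd : PlimMomentDominatedOnBoxOf F fam ρ bV γ) :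
    BetaContH γ (fun k v => B12Beta.secondMoment (plimOf F fam ρ bV k v) 0 1) := fun k => by
  obtain ⟨m, hm, hdom⟩ := hd k
  have h := continuousOn_tsum (f := fun (z : Fin 4 → ℤ) (v : Fin (k + 1) → ℝ) => plimOf F fam ρ bV k v 0 1 z * (z 0 : ℝ) * (z 1 : ℝ))
    (fun z => ((hc k z).mul continuousOn_const).mul continuousOn_const) hm
    (fun z v hv => by rw [Real.norm_eq_abs, abs_mul, abs_mul]; exact hdom v hv z)
  exact h.congr fun v _ => rfl

/-- **(T-β1) + per-scale (5.10) + (V-cont-ev) ⟹ (C) ON THE BOXES** (the rated road `K0AxMomentRoad.betaContH_thetaFill_of_cont_decayBox`, generic). [cite: Balaban1987RG1, (1.22) p.264, (5.10) p.293] -/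
theorem betaContH_secondMoment_plimOf_of_locUnif_of_decayBox_of_contEv {γ : ℝ} (h1 : PolLimitLocUnifOnBoxOf F fam ρ bV γ)
    (h2 : ∀ k : ℕ, ∃ C δ₁ : ℝ, 0 < δ₁ ∧ ∀ (v : Fin (k + 1) → ℝ), v ∈ Box γ k → Decay510 (plimOf F fam ρ bV k v 0 1) C δ₁)
    (h3 : PvolContEvOnBoxOf F fam ρ bV γ) : BetaContH γ (fun k v => B12Beta.secondMoment (plimOf F fam ρ bV k v) 0 1) :=
  betaContH_secondMoment_plimOf_of_cont_dominated F fam ρ bV (plimContOnBoxOf_of_locUnif_of_contEv F fam ρ bV h1 h3)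
    (plimMomentDominatedOnBoxOf_of_decayBox F fam ρ bV h2)

/-- **★ PTB-1's KERNEL OVER THE NAMES**: (T-β1) + (T-β2) + (T-β3) ⟹ `BetaContH γ (fun k v => secondMoment (plimOf F fam ρ bV k v) 0 1)` — ✓`K1AxBetaContKernel.betaContH_secondMoment_plimOf`,
whose binders ARE these letters' bodies. [cite: Balaban1987RG1, §1 pp.263–264, (1.21)–(1.22) p.264, (5.10) p.293] -/
theorem betaContH_secondMoment_plimOf_of_letters {γ C δ₁ : ℝ} (h1 : PolLimitLocUnifOnBoxOf F fam ρ bV γ) (h2 : PlimDecayOnBoxOf F fam ρ bV γ C δ₁)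
    (h3 : PvolHistContOnBoxOf F fam ρ bV γ) : BetaContH γ (fun k v => B12Beta.secondMoment (plimOf F fam ρ bV k v) 0 1) :=
  K1AxBetaContKernel.betaContH_secondMoment_plimOf F fam ρ bV h1 h2 h3

/-! ### §1b  LEVEL MONOTONICITY: every letter restricts to a smaller box `γ' ≤ γ` (`FlowStep.box_mono`) — the citable generic home of these one-liners
(dag-lead WORDS 745∕746; consumers shrink levels to `min γ₀ w.γ`) -/

/-- (T-β1) restricts to smaller boxes (`TendstoLocallyUniformlyOn.mono`). [folklore] -/
theorem polLimitLocUnifOnBoxOf_mono {γ γ' : ℝ} (hle : γ' ≤ γ) (h : PolLimitLocUnifOnBoxOf F fam ρ bV γ) : PolLimitLocUnifOnBoxOf F fam ρ bV γ' :=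
  fun k z => (h k z).mono (FlowStep.box_mono hle k)

/-- (T-β2) restricts to smaller boxes. [cite: Balaban1987RG1, (5.10) p.293 (bookkeeping)] -/
theorem plimDecayOnBoxOf_mono {γ γ' C δ₁ : ℝ} (hle : γ' ≤ γ) (h : PlimDecayOnBoxOf F fam ρ bV γ C δ₁) : PlimDecayOnBoxOf F fam ρ bV γ' C δ₁ :=
  ⟨h.1, fun k v hv => h.2 k v (box_mono hle hv)⟩

/-- (T-β3) restricts to smaller boxes (`ContinuousOn.mono`). [folklore] -/
theorem pvolHistContOnBoxOf_mono {γ γ' : ℝ} (hle : γ' ≤ γ) (h : PvolHistContOnBoxOf F fam ρ bV γ) : PvolHistContOnBoxOf F fam ρ bV γ' :=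
  fun k K z => (h k K z).mono (FlowStep.box_mono hle k)

/-- (V-cont-ev) restricts to smaller boxes. [folklore] -/
theorem pvolContEvOnBoxOf_mono {γ γ' : ℝ} (hle : γ' ≤ γ) (h : PvolContEvOnBoxOf F fam ρ bV γ) : PvolContEvOnBoxOf F fam ρ bV γ' :=
  fun k z => (h k z).mono fun _ hK => hK.mono (FlowStep.box_mono hle k)

/-- (V-lucauchy) restricts to smaller boxes (the relative neighbourhood is cut down: `nhdsWithin_mono`, `UniformCauchySeqOn.mono`). [folklore] -/
theorem pvolLocUnifCauchyOnBoxOf_mono {γ γ' : ℝ} (hle : γ' ≤ γ) (h : PvolLocUnifCauchyOnBoxOf F fam ρ bV γ) : PvolLocUnifCauchyOnBoxOf F fam ρ bV γ' := by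
  intro k z v hv
  obtain ⟨t, ht, hU⟩ := h k z v (box_mono hle hv)
  exact ⟨t, nhdsWithin_mono v (FlowStep.box_mono hle k) ht, hU⟩

/-- (L-cont) restricts to smaller boxes. [folklore] -/
theorem plimContOnBoxOf_mono {γ γ' : ℝ} (hle : γ' ≤ γ) (h : PlimContOnBoxOf F fam ρ bV γ) : PlimContOnBoxOf F fam ρ bV γ' :=
  fun k z => (h k z).mono (FlowStep.box_mono hle k)

/-- (L-dom) restricts to smaller boxes. [folklore] -/
theorem plimMomentDominatedOnBoxOf_mono {γ γ' : ℝ} (hle : γ' ≤ γ) (h : PlimMomentDominatedOnBoxOf F fam ρ bV γ) : PlimMomentDominatedOnBoxOf F fam ρ bV γ' := fun k => by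
  obtain ⟨m, hm, hdom⟩ := h k
  exact ⟨m, hm, fun v hv z => hdom v (box_mono hle hv) z⟩

end Generic

/-! ## §2  THE K0 INSTANCES: the K0 road's letters at `thetaFill F a₀ ε₂₉` ARE the generic letters at `(recordTermsAx F a₀ ε₂₉, θfill.ρ8, θfill.bV)` -/

section K0

variable (a₀ ε₂₉ : ℝ)

/-- `famOfRecord₁₃Ax` at the K0 tuple `thetaFill F a₀ ε₂₉` IS `recordTermsAx F a₀ ε₂₉` (`rfl`). [cite: Balaban1987RG1, (1.6) p.261, (2.9) p.266 (bookkeeping)] -/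
theorem famOfRecord₁₃Ax_thetaFill : famOfRecord₁₃Ax F 2 (thetaFill F a₀ ε₂₉) = recordTermsAx F a₀ ε₂₉ := rfl

/-- (V-cont-box) of the K0 road IS (V-cont-ev) at the K0 instance (`Iff.rfl`). [cite: Balaban1987RG1, (1.20)–(1.22) p.264 (bookkeeping)] -/
theorem recordPvolContOnBoxAx_iff (γ : ℝ) :
    RecordPvolContOnBoxAx F a₀ ε₂₉ γ ↔
      (letI θ := thetaFill F a₀ ε₂₉
       letI := θ.instVβ₁; letI := θ.instVβ₂; letI := θ.instιβ
       PvolContEvOnBoxOf F (recordTermsAx F a₀ ε₂₉) θ.ρ8 θ.bV γ) := Iff.rfl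

/-- (V-lucauchy-box) of the K0 road IS (V-lucauchy) at the K0 instance (`Iff.rfl`). [cite: Balaban1987RG1, (1.21) p.264 (bookkeeping)] -/
theorem recordPvolLocUniformCauchyOnBoxAx_iff (γ : ℝ) :
    RecordPvolLocUniformCauchyOnBoxAx F a₀ ε₂₉ γ ↔
      (letI θ := thetaFill F a₀ ε₂₉
       letI := θ.instVβ₁; letI := θ.instVβ₂; letI := θ.instιβ
       PvolLocUnifCauchyOnBoxOf F (recordTermsAx F a₀ ε₂₉) θ.ρ8 θ.bV γ) := Iff.rfl

/-- (L-cont-box) of the K0 road IS (L-cont) at the K0 instance (`Iff.rfl`). [cite: Balaban1987RG1, §1 p.264 (bookkeeping)] -/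
theorem recordPlimContOnBoxAx_iff (γ : ℝ) :
    RecordPlimContOnBoxAx F a₀ ε₂₉ γ ↔
      (letI θ := thetaFill F a₀ ε₂₉
       letI := θ.instVβ₁; letI := θ.instVβ₂; letI := θ.instιβ
       PlimContOnBoxOf F (recordTermsAx F a₀ ε₂₉) θ.ρ8 θ.bV γ) := Iff.rfl

/-- (L-dom-box) of the K0 road IS (L-dom) at the K0 instance (`Iff.rfl`). [cite: Balaban1987RG1, (1.22) p.264 (bookkeeping)] -/
theorem recordPlimMomentDominatedOnBoxAx_iff (γ : ℝ) :
    RecordPlimMomentDominatedOnBoxAx F a₀ ε₂₉ γ ↔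
      (letI θ := thetaFill F a₀ ε₂₉
       letI := θ.instVβ₁; letI := θ.instVβ₂; letI := θ.instιβ
       PlimMomentDominatedOnBoxOf F (recordTermsAx F a₀ ε₂₉) θ.ρ8 θ.bV γ) := Iff.rfl

/-- (T-β3) at the Stage-13-Ax instance `thetaFill F a₀ ε₂₉` reads the K0 road's finite-volume kernels `recordPvolAx` (`Iff.rfl`). [cite: Balaban1987RG1, (1.20)–(1.21) p.264 (bookkeeping)] -/
theorem pvolHistContOnBox₁₃Ax_thetaFill_iff (γ : ℝ) :
    PvolHistContOnBox₁₃Ax F 2 (thetaFill F a₀ ε₂₉) γ ↔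
      ∀ (k K : ℕ) (z : Fin 4 → ℤ), ContinuousOn (fun v : Fin (k + 1) → ℝ => recordPvolAx F a₀ ε₂₉ k v K 0 1 z) (Box γ k) := Iff.rfl

/-- (T-β1) at the Stage-13-Ax instance `thetaFill F a₀ ε₂₉` reads `recordPvolAx ∕ recordPlimAx` (`Iff.rfl`). [cite: Balaban1987RG1, (1.21) p.264 (bookkeeping)] -/
theorem polLimitLocUnifOnBox₁₃Ax_thetaFill_iff (γ : ℝ) :
    PolLimitLocUnifOnBox₁₃Ax F 2 (thetaFill F a₀ ε₂₉) γ ↔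
      ∀ (k : ℕ) (z : Fin 4 → ℤ), TendstoLocallyUniformlyOn (fun K (v : Fin (k + 1) → ℝ) => recordPvolAx F a₀ ε₂₉ k v K 0 1 z)
        (fun v => recordPlimAx F a₀ ε₂₉ k v 0 1 z) atTop (Box γ k) := Iff.rfl

/-- (T-β2) at the Stage-13-Ax instance `thetaFill F a₀ ε₂₉` IS edition 12's box receipt at the K0 instance (`Iff.rfl`). [cite: Balaban1987RG1, (5.10) p.293 (bookkeeping)] -/
theorem plimDecayOnBox₁₃Ax_thetaFill_iff (γ C δ₁ : ℝ) :
    PlimDecayOnBox₁₃Ax F 2 (thetaFill F a₀ ε₂₉) γ C δ₁ ↔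
      (letI θ := thetaFill F a₀ ε₂₉
       letI := θ.instVβ₁; letI := θ.instVβ₂; letI := θ.instιβ
       PlimDecayOnBoxOf F (recordTermsAx F a₀ ε₂₉) θ.ρ8 θ.bV γ C δ₁) := Iff.rfl

/-- **THE K0 ROAD's (C) KERNEL RECOVERED from the generic one**: (L-cont-box) + (L-dom-box) ⟹ `BetaContH γ (betaOfRecord₁₃Ax F 2 (thetaFill F a₀ ε₂₉))` for `γ ≤ ½` — by
`betaContH_secondMoment_plimOf_of_cont_dominated` at the K0 instance and the box identity `betaOfRecord₁₃Ax_thetaFill_of_mem_box` (same statement as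
`K0AxMomentRoad.betaContH_thetaFill_of_cont_dominated`; recorded to show the two roads agree). [cite: Balaban1987RG1, (1.22) p.264, (5.42) p.297] -/
theorem betaContH_thetaFill_of_cont_dominated' {γ : ℝ} (hγh : γ ≤ 1 / 2) (hc : RecordPlimContOnBoxAx F a₀ ε₂₉ γ)
    (hd : RecordPlimMomentDominatedOnBoxAx F a₀ ε₂₉ γ) : BetaContH γ (betaOfRecord₁₃Ax F 2 (thetaFill F a₀ ε₂₉)) := fun k => by
  letI θ := thetaFill F a₀ ε₂₉
  letI := θ.instVβ₁; letI := θ.instVβ₂; letI := θ.instιβ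
  exact ((betaContH_secondMoment_plimOf_of_cont_dominated F (recordTermsAx F a₀ ε₂₉) θ.ρ8 θ.bV hc hd) k).congr fun v hv =>
    betaOfRecord₁₃Ax_thetaFill_of_mem_box F a₀ ε₂₉ (box_mono hγh hv)

end K0

/-! ## §3  RECORD FACES OVER THE NAMES: the re-centred Stage-13 β of record (★ PTB-1's ✓p820605 §4, re-read through edition 25's instances) -/

section Stage13Ax

variable {F}
variable {N : ℕ} [NeZero N]

/-- **ON ITS BOX the re-centred Stage-13 β of record IS the (1.22)-moment of `plimOf` of `famOfRecord₁₃Ax`** (`betaOfRecord₁₃Ax` is `betaOfRecord₈Tχ … θ.toStage8Params` by `rfl`;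
✓`K0RecordFormatNamesLemmas4.betaOfRecord₈Tχ_of_mem_box`). [cite: Balaban1987RG1, (1.22) p.264] -/
theorem betaOfRecord₁₃Ax_eq_secondMoment_plimOf (θ : Stage13Params F N) {k : ℕ} {v : Fin (k + 1) → ℝ} (hv : v ∈ Box θ.γ k) :
    betaOfRecord₁₃Ax F N θ k v =
      (letI := θ.instVβ₁; letI := θ.instVβ₂; letI := θ.instιβ
       B12Beta.secondMoment (plimOf F (famOfRecord₁₃Ax F N θ) θ.ρ8 θ.bV k v) 0 1) :=
  betaOfRecord₈Tχ_of_mem_box F (TβOfRecord₁₃ F N) (chiβOfRecord₁₃Ax F N θ) θ.toStage8Params hv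

/-- The Stage-13-Ax instance of (T-β1) restricts to smaller boxes. [folklore] -/
theorem polLimitLocUnifOnBox₁₃Ax_mono (θ : Stage13Params F N) {γ γ' : ℝ} (hle : γ' ≤ γ) (h : PolLimitLocUnifOnBox₁₃Ax F N θ γ) :
    PolLimitLocUnifOnBox₁₃Ax F N θ γ' := by
  letI := θ.instVβ₁; letI := θ.instVβ₂; letI := θ.instιβ
  exact polLimitLocUnifOnBoxOf_mono F _ θ.ρ8 θ.bV hle h

/-- The Stage-13-Ax instance of (T-β2) restricts to smaller boxes. [cite: Balaban1987RG1, (5.10) p.293 (bookkeeping)] -/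
theorem plimDecayOnBox₁₃Ax_mono (θ : Stage13Params F N) {γ γ' C δ₁ : ℝ} (hle : γ' ≤ γ) (h : PlimDecayOnBox₁₃Ax F N θ γ C δ₁) :
    PlimDecayOnBox₁₃Ax F N θ γ' C δ₁ := by
  letI := θ.instVβ₁; letI := θ.instVβ₂; letI := θ.instιβ
  exact plimDecayOnBoxOf_mono F _ θ.ρ8 θ.bV hle h

/-- The Stage-13-Ax instance of (T-β3) restricts to smaller boxes. [folklore] -/
theorem pvolHistContOnBox₁₃Ax_mono (θ : Stage13Params F N) {γ γ' : ℝ} (hle : γ' ≤ γ) (h : PvolHistContOnBox₁₃Ax F N θ γ) :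
    PvolHistContOnBox₁₃Ax F N θ γ' := by
  letI := θ.instVβ₁; letI := θ.instVβ₂; letI := θ.instιβ
  exact pvolHistContOnBoxOf_mono F _ θ.ρ8 θ.bV hle h

/-- ★ **(T-β1) + (T-β2) + (T-β3) AT THE STAGE-13-Ax RECORD `θ` on a box of side `γ ≤ θ.γ` ⟹ (C) `BetaContH γ₀ (betaOfRecord₁₃Ax F N θ)` at every level `γ₀ ≤ γ`** — ★ PTB-1's
✓`K1AxBetaContKernel.betaContH_betaOfRecord₈Tχ_of_kernelLetters` read over the NAMES (by unfolding).  CONDITIONAL; the letters are OPEN, discharged by nobody.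
[cite: Balaban1987RG1, §1 pp.263–264, (1.21)–(1.22) p.264, (5.10) p.293] -/
theorem betaContH_betaOfRecord₁₃Ax_of_letters₁₃Ax (θ : Stage13Params F N) {γ γ₀ C δ₁ : ℝ} (hle : γ₀ ≤ γ) (hγ : γ ≤ θ.γ)
    (h1 : PolLimitLocUnifOnBox₁₃Ax F N θ γ) (h2 : PlimDecayOnBox₁₃Ax F N θ γ C δ₁) (h3 : PvolHistContOnBox₁₃Ax F N θ γ) :
    BetaContH γ₀ (betaOfRecord₁₃Ax F N θ) :=
  K1AxBetaContKernel.betaContH_betaOfRecord₈Tχ_of_kernelLetters (TβOfRecord₁₃ F N) (chiβOfRecord₁₃Ax F N θ) θ.toStage8Params hle hγ h1 h2 h3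

/-- ★★ **… ⟹ RUN-WISE SURVIVOR CONTINUITY `SurvCont (betaOfRecord₁₃Ax F N θ) γ₀` at every level `0 < γ₀ ≤ γ`** (`SurvCont.of_betaContH`) — the (C) conjunct K1ᴬ's `stub_cont13` adds to
the run rows at a witness, GIVEN the three β-kernel letters at `θ` BY NAME.  CONDITIONAL; the letters are OPEN ((T-β1)(T-β2) = [I] §1∕§5 at the record), discharged by nobody;
K1ᴬ OPEN. [cite: Balaban1987RG1, §1 pp.263–264, (1.21)–(1.22) p.264, (5.10) p.293] -/
theorem survCont_betaOfRecord₁₃Ax_of_letters₁₃Ax (θ : Stage13Params F N) {γ γ₀ C δ₁ : ℝ} (hγ₀ : 0 < γ₀) (hle : γ₀ ≤ γ) (hγ : γ ≤ θ.γ)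
    (h1 : PolLimitLocUnifOnBox₁₃Ax F N θ γ) (h2 : PlimDecayOnBox₁₃Ax F N θ γ C δ₁) (h3 : PvolHistContOnBox₁₃Ax F N θ γ) :
    SurvCont (betaOfRecord₁₃Ax F N θ) γ₀ :=
  SurvCont.of_betaContH hγ₀ (betaContH_betaOfRecord₁₃Ax_of_letters₁₃Ax θ hle hγ h1 h2 h3)

/-- **… the RATE-FREE variant at `θ`**: (T-β1) + per-scale (5.10) + (T-β3) at the record's family ⟹ `SurvCont (betaOfRecord₁₃Ax F N θ) γ₀` (`0 < γ₀ ≤ γ ≤ θ.γ`) — through §1's generic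
(C) kernel instead of the one-`(C, δ₁)` letter. CONDITIONAL. [cite: Balaban1987RG1, §1 pp.263–264, (1.22) p.264, (5.10) p.293] -/
theorem survCont_betaOfRecord₁₃Ax_of_locUnif_of_decayBox_of_histCont (θ : Stage13Params F N) {γ γ₀ : ℝ} (hγ₀ : 0 < γ₀) (hle : γ₀ ≤ γ) (hγ : γ ≤ θ.γ)
    (h1 : PolLimitLocUnifOnBox₁₃Ax F N θ γ)
    (h2 : letI := θ.instVβ₁; letI := θ.instVβ₂; letI := θ.instιβ
      ∀ k : ℕ, ∃ C δ₁ : ℝ, 0 < δ₁ ∧ ∀ (v : Fin (k + 1) → ℝ), v ∈ Box γ k → Decay510 (plimOf F (famOfRecord₁₃Ax F N θ) θ.ρ8 θ.bV k v 0 1) C δ₁)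
    (h3 : PvolHistContOnBox₁₃Ax F N θ γ) : SurvCont (betaOfRecord₁₃Ax F N θ) γ₀ := by
  letI := θ.instVβ₁; letI := θ.instVβ₂; letI := θ.instιβ
  refine SurvCont.of_betaContH hγ₀ fun k => ?_
  have h := betaContH_secondMoment_plimOf_of_locUnif_of_decayBox_of_contEv F (famOfRecord₁₃Ax F N θ) θ.ρ8 θ.bV h1 h2
    (pvolContEvOnBoxOf_of_pvolHistContOnBoxOf F _ θ.ρ8 θ.bV h3)
  exact ((h k).congr fun v hv => betaOfRecord₁₃Ax_eq_secondMoment_plimOf θ (box_mono hγ hv)).mono (FlowStep.box_mono hle k)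

end Stage13Ax

end Summit.QuantumFields.YangMills.Theorems.K0RecordFormatNames

end
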